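import Literature.Analysis.FluidPDE.EssCurry
import Literature.Analysis.FluidPDE.TsaiMaximumPrinciple
import HarnessLib

/-!
# A Lipschitz bound for classical solutions of `|∂ₜg + Δg| ≤ N` by doubling the variables

Analysis/FluidPDE proof file (theorems only) in the backward-uniqueness track of **ns.S08**
(`Literature.Analysis.FluidPDE.ess_endpoint`): first step of the discharge of the named fact
`Carleman.seregin_backwardHeat_halfspace_gradient_growth` (`BackwardHeatRegularity.lean`;
Seregin 2014, App. A.3, (A.3.7): the interior gradient bound "from the regularity theory of
parabolic equations" for functions satisfying the backward heat inequality
`|∂ₜu + Δu| ≤ c₁(|u| + |∇u|)`).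

The regularity theory Seregin quotes (Ladyženskaja–Solonnikov–Ural'ceva 1968) is not available;
for the `C²` functions of the vendored statement an elementary substitute suffices, and this file
proves its analytic core, a **global Lipschitz bound for classical solutions of the backward heat
equation with bounded right-hand side**, by the doubling-of-variables maximum principle
(Kružkov's device; Ishii–Lions 1990 for viscosity solutions — here in the trivial classical case):

* `Carleman.doubling_sub_le` — if `g : ℝ × E → ℝ` is `C²` on an open set containing
  `[t₁, ∞) × E`, vanishes for `t ≥ T` and for `|x| ≥ R₀`, and satisfies `|g| ≤ W` and
  `|∂ₜg + Δg| ≤ N < 4K` on `t ≥ t₁`, then with `L = √(8KW)`, `δ = L/(2K)`: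
  `g(t, x) - g(t, y) ≤ L|x - y| - K|x - y|²` whenever `t ≥ t₁`, `|x - y| ≤ δ`.
  Proof: a positive maximum of `Ψ(t, x, y) = g(t,x) - g(t,y) - φ(|x-y|)`, `φ(r) = Lr - Kr²`, over
  `{t ≥ t₁, |x - y| ≤ δ}` is attained (compact support) at a point with `0 < |x̂ - ŷ| < δ`
  (`φ(0) = 0`, `φ(δ) = 2W`); there the one-sided condition in `t` (the bottom `t = t₁` is allowed:
  `∂ₜ(g(·,x̂) - g(·,ŷ)) ≤ 0`, the backward operator being solved downwards in time), the parallel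
  translations `(ξ, ξ)` (`D²g(x̂)[ξ,ξ] ≤ D²g(ŷ)[ξ,ξ]`) and the opposite translation `(p, -p)` along
  `p = (x̂ - ŷ)/|x̂ - ŷ|` (`D²g(x̂)[p,p] - D²g(ŷ)[p,p] ≤ 4φ'' = -8K`), summed over an orthonormal
  basis containing `p`, give `(∂ₜ + Δ)g(x̂) - (∂ₜ + Δ)g(ŷ) ≤ -8K < -2N`, a contradiction.
* `Carleman.norm_fderiv_slice_le_sqrt` — consequently `‖∇ₓg(t, x)‖ ≤ √(2NW)` for `t ≥ t₁`
  (`K ↓ N/4`);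
* `Carleman.gradSq_le_of_sub_le` — the vector-valued form: for `w : ℝ × E → F` under the same
  hypotheses with norms, `|∇ₓw(t,x)|² = gradSq w (t,x) ≤ (dim E) · 2NW` (apply the scalar bound to
  `⟪w, v⟫`).

Everything is stated for the uncurried frame operators `Carleman.dt`, `Carleman.lap`,
`Carleman.gradSq` of `CarlemanCalculus.lean` (dictionary `EssCurry.lean`).

## References

* G. Seregin, *Lecture notes on regularity theory for the Navier–Stokes equations*, World
  Scientific 2014, App. A.3, (A.3.7) (the estimate served). [Seregin2014]
* S. N. Kružkov, *First order quasilinear equations in several independent variables*,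
  Math. USSR Sb. 10 (1970) 217–243, §3 (doubling of variables).
* H. Ishii, P.-L. Lions, *Viscosity solutions of fully nonlinear second-order elliptic partial
  differential equations*, J. Differential Equations 83 (1990) 26–78, §VII (Lipschitz bounds by
  comparison with `φ(|x - y|)`).
-/

noncomputable section

open Set Function Filter Topology InnerProductSpace Metric
open scoped InnerProductSpace RealInnerProductSpace Laplacian

namespace Literature.Analysis.FluidPDE

namespace Carleman

/-! ### One-dimensional second-order conditions along lines -/

section Lines

variable {E : Type*} [NormedAddCommGroup E] [InnerProductSpace ℝ E]

/-- The derivative of `σ ↦ V(x + σv)` is `σ ↦ DV(x + σv) v`. [folklore] -/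
theorem deriv_comp_line_eq {V : E → ℝ} (hV : Differentiable ℝ V) (x v : E) :
    deriv (fun σ : ℝ => V (x + σ • v)) = fun σ => fderiv ℝ V (x + σ • v) v := by
  funext σ
  have hl : HasDerivAt (fun σ : ℝ => x + σ • v) v σ := by
    simpa using ((hasDerivAt_id σ).smul_const v).const_add x
  exact ((hV (x + σ • v)).hasFDerivAt.comp_hasDerivAt σ hl).deriv

/-- `σ ↦ V(x + σv)` is differentiable for differentiable `V`. [folklore] -/
theorem differentiable_comp_line {V : E → ℝ} (hV : Differentiable ℝ V) (x v : E) :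
    Differentiable ℝ fun σ : ℝ => V (x + σ • v) :=
  hV.comp ((differentiable_const x).add (differentiable_id.smul_const v))

/-- The derivative of `σ ↦ V(x + σv)` is differentiable for `V ∈ C²`. [folklore] -/
theorem differentiable_deriv_comp_line {V : E → ℝ} (hV : ContDiff ℝ 2 V) (x v : E) :
    Differentiable ℝ (deriv fun σ : ℝ => V (x + σ • v)) := by
  rw [deriv_comp_line_eq (hV.differentiable (by norm_num)) x v]
  have hD : Differentiable ℝ fun y => fderiv ℝ V y v :=
    ((hV.fderiv_right (m := 1) le_rfl).differentiable one_ne_zero).clm_apply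
      (differentiable_const v)
  exact hD.comp ((differentiable_const x).add (differentiable_id.smul_const v))

/-- **Parallel translations.** If `σ ↦ V(x + σξ) - V(y + σξ)` has a local maximum at `σ = 0`
for a `C²` function `V`, then `D²V(x)[ξ, ξ] - D²V(y)[ξ, ξ] ≤ 0`. [folklore] -/
theorem iteratedFDeriv_sub_nonpos_of_isLocalMax {V : E → ℝ} (hV : ContDiff ℝ 2 V) (x y ξ : E)
    (h : IsLocalMax (fun σ : ℝ => V (x + σ • ξ) - V (y + σ • ξ)) 0) :
    iteratedFDeriv ℝ 2 V x ![ξ, ξ] - iteratedFDeriv ℝ 2 V y ![ξ, ξ] ≤ 0 := by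
  have hV1 : Differentiable ℝ V := hV.differentiable (by norm_num)
  have hA := differentiable_comp_line hV1 x ξ
  have hB := differentiable_comp_line hV1 y ξ
  have hdA := differentiable_deriv_comp_line hV x ξ
  have hdB := differentiable_deriv_comp_line hV y ξ
  have h1 : deriv (fun σ : ℝ => V (x + σ • ξ) - V (y + σ • ξ)) =
      fun σ => deriv (fun σ : ℝ => V (x + σ • ξ)) σ - deriv (fun σ : ℝ => V (y + σ • ξ)) σ := by
    funext σ
    exact deriv_fun_sub (hA σ) (hB σ)
  have h2 : deriv (deriv fun σ : ℝ => V (x + σ • ξ) - V (y + σ • ξ)) 0 =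
      deriv (deriv fun σ : ℝ => V (x + σ • ξ)) 0 - deriv (deriv fun σ : ℝ => V (y + σ • ξ)) 0 := by
    rw [h1]
    exact deriv_fun_sub (hdA 0) (hdB 0)
  have hc : ContinuousAt (fun σ : ℝ => V (x + σ • ξ) - V (y + σ • ξ)) 0 :=
    (hA.sub hB).continuous.continuousAt
  have := deriv_deriv_nonpos_of_isLocalMax h hc
  rwa [h2, deriv_deriv_comp_line hV x ξ, deriv_deriv_comp_line hV y ξ] at this

/-- **Opposite translations against the barrier `φ(r) = Lr - Kr²`.** If
`σ ↦ V(x + σp) - V(y - σp) - φ(r + 2σ)` has a local maximum at `σ = 0` for a `C²` function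
`V`, then `D²V(x)[p, p] - D²V(y)[p, p] + 8K ≤ 0` (`(d/dσ)² φ(r + 2σ) = 4φ'' = -8K`). [folklore] -/
theorem iteratedFDeriv_sub_add_le_of_isLocalMax {V : E → ℝ} (hV : ContDiff ℝ 2 V) (x y p : E)
    (L K r : ℝ)
    (h : IsLocalMax (fun σ : ℝ => V (x + σ • p) - V (y + σ • (-p)) -
      (L * (r + 2 * σ) - K * (r + 2 * σ) ^ 2)) 0) :
    iteratedFDeriv ℝ 2 V x ![p, p] - iteratedFDeriv ℝ 2 V y ![p, p] + 8 * K ≤ 0 := by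
  have hV1 : Differentiable ℝ V := hV.differentiable (by norm_num)
  have hA := differentiable_comp_line hV1 x p
  have hB := differentiable_comp_line hV1 y (-p)
  have hdA := differentiable_deriv_comp_line hV x p
  have hdB := differentiable_deriv_comp_line hV y (-p)
  -- the barrier term
  set Φ : ℝ → ℝ := fun σ => L * (r + 2 * σ) - K * (r + 2 * σ) ^ 2 with hΦ
  have hl : ∀ σ : ℝ, HasDerivAt (fun σ : ℝ => r + 2 * σ) 2 σ := fun σ => by
    simpa using ((hasDerivAt_id σ).const_mul (2 : ℝ)).const_add r
  have hΦ1 : ∀ σ, HasDerivAt Φ (2 * L - 4 * K * (r + 2 * σ)) σ := fun σ => by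
    have hsq : HasDerivAt (fun x : ℝ => (r + 2 * x) ^ 2) (2 * (r + 2 * σ) * 2) σ :=
      ((hl σ).pow 2).congr_deriv (by norm_num)
    have h2 := ((hl σ).const_mul L).sub (hsq.const_mul K)
    exact h2.congr_deriv (by ring)
  have hΦd : Differentiable ℝ Φ := fun σ => (hΦ1 σ).differentiableAt
  have hΦ1' : deriv Φ = fun σ => 2 * L - 4 * K * (r + 2 * σ) := funext fun σ => (hΦ1 σ).deriv
  have hΦ2 : HasDerivAt (deriv Φ) (-(4 * K * 2)) 0 := by
    rw [hΦ1']
    exact ((hl 0).const_mul (4 * K)).const_sub (2 * L)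
  have hΦdd : DifferentiableAt ℝ (deriv Φ) 0 := hΦ2.differentiableAt
  -- second derivative of the whole expression
  have h1 : deriv (fun σ : ℝ => V (x + σ • p) - V (y + σ • (-p)) - Φ σ) =
      fun σ => deriv (fun σ : ℝ => V (x + σ • p)) σ - deriv (fun σ : ℝ => V (y + σ • (-p))) σ -
        deriv Φ σ := by
    funext σ
    rw [deriv_fun_sub ((hA σ).fun_sub (hB σ)) (hΦd σ), deriv_fun_sub (hA σ) (hB σ)]
  have h2 : deriv (deriv fun σ : ℝ => V (x + σ • p) - V (y + σ • (-p)) - Φ σ) 0 =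
      deriv (deriv fun σ : ℝ => V (x + σ • p)) 0 - deriv (deriv fun σ : ℝ => V (y + σ • (-p))) 0 -
        deriv (deriv Φ) 0 := by
    rw [h1, deriv_fun_sub ((hdA 0).fun_sub (hdB 0)) hΦdd, deriv_fun_sub (hdA 0) (hdB 0)]
  have hc : ContinuousAt (fun σ : ℝ => V (x + σ • p) - V (y + σ • (-p)) - Φ σ) 0 :=
    ((hA.sub hB).sub hΦd).continuous.continuousAt
  have hmax := deriv_deriv_nonpos_of_isLocalMax h hc
  rw [h2, deriv_deriv_comp_line hV x p, deriv_deriv_comp_line hV y (-p), hΦ2.deriv] at hmax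
  have hneg : iteratedFDeriv ℝ 2 V y ![-p, -p] = iteratedFDeriv ℝ 2 V y ![p, p] := by
    simp only [iteratedFDeriv_two_apply, Matrix.cons_val_zero, Matrix.cons_val_one,
      Matrix.cons_val_fin_one, map_neg, neg_apply, neg_neg]
  rw [hneg] at hmax
  linarith

/-- **One-sided first-order condition.** If `θ` is differentiable at `a` with derivative `θ'`
and `θ s ≤ θ a` for all `s > a` close to `a`, then `θ' ≤ 0`. [folklore] -/
theorem hasDerivAt_nonpos_of_forall_gt_le {θ : ℝ → ℝ} {θ' a : ℝ} (hθ : HasDerivAt θ θ' a)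
    (h : ∀ᶠ s in 𝓝[>] a, θ s ≤ θ a) : θ' ≤ 0 := by
  have ht : Tendsto (slope θ a) (𝓝[>] a) (𝓝 θ') :=
    (hasDerivAt_iff_tendsto_slope.1 hθ).mono_left (nhdsWithin_mono _ fun s hs => ne_of_gt hs)
  refine le_of_tendsto ht ?_
  filter_upwards [h, self_mem_nhdsWithin] with s hs hs'
  rw [slope_def_field]
  exact div_nonpos_of_nonpos_of_nonneg (sub_nonpos.2 hs) (sub_nonneg.2 (le_of_lt hs'))

end Lines

/-! ### An orthonormal basis through a unit vector -/

section Basis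

variable {E : Type*} [NormedAddCommGroup E] [InnerProductSpace ℝ E] [FiniteDimensional ℝ E]

/-- A unit vector is a member of some orthonormal basis indexed by `Fin (dim E)`. [folklore] -/
theorem exists_orthonormalBasis_apply_eq {p : E} (hp : ‖p‖ = 1) :
    ∃ (b : OrthonormalBasis (Fin (Module.finrank ℝ E)) ℝ E) (i₀ : Fin (Module.finrank ℝ E)),
      b i₀ = p := by
  have hp0 : p ≠ 0 := by
    rintro rfl
    simp at hp
  have hn : 0 < Module.finrank ℝ E := Module.finrank_pos_iff_exists_ne_zero.2 ⟨p, hp0⟩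
  set i₀ : Fin (Module.finrank ℝ E) := ⟨0, hn⟩
  have hv : Orthonormal ℝ (({i₀} : Set (Fin (Module.finrank ℝ E))).restrict fun _ => p) := by
    rw [orthonormal_subsingleton_iff]
    intro i
    exact hp
  obtain ⟨b, hb⟩ := Orthonormal.exists_orthonormalBasis_extension_of_card_eq
    (𝕜 := ℝ) (E := E) (Fintype.card_fin _).symm hv
  exact ⟨b, i₀, hb i₀ rfl⟩

end Basis

/-! ### The doubling argument -/

section Doubling

variable {E : Type*} [NormedAddCommGroup E] [InnerProductSpace ℝ E] [FiniteDimensional ℝ E]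

omit [FiniteDimensional ℝ E] in
/-- Slices in `x` of a function `C²` on an open set containing `[t₁, ∞) × E` are `C²`. [folklore] -/
theorem contDiff_slice_of_subset {F : Type*} [NormedAddCommGroup F] [NormedSpace ℝ F]
    {g : ℝ × E → F} {U : Set (ℝ × E)} {t₁ : ℝ}
    (hsub : Ici t₁ ×ˢ univ ⊆ U) (hg : ContDiffOn ℝ 2 g U) {t : ℝ} (ht : t₁ ≤ t) :
    ContDiff ℝ 2 fun y => g (t, y) :=
  hg.comp_contDiff (contDiff_const.prodMk contDiff_id) fun y => hsub ⟨mem_Ici.2 ht, mem_univ y⟩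

omit [FiniteDimensional ℝ E] in
/-- Slices in `t` of a function differentiable at `(t, x)` are differentiable at `t`, with
derivative `DG(t,x)(1,0) = dt G (t, x)`. [folklore] -/
theorem hasDerivAt_slice_dt {F : Type*} [NormedAddCommGroup F] [NormedSpace ℝ F]
    {g : ℝ × E → F} {t : ℝ} {x : E} (hd : DifferentiableAt ℝ g (t, x)) :
    HasDerivAt (fun s => g (s, x)) (dt g (t, x)) t := by
  have h : HasFDerivAt (fun s => g (s, x)) ((fderiv ℝ g (t, x)).comp (ContinuousLinearMap.inl ℝ ℝ E)) t :=
    hd.hasFDerivAt.comp t (hasFDerivAt_prodMk_left t x)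
  have h' := h.hasDerivAt
  simpa [dt] using h'

/-- **Doubling of variables** (the core estimate). Let `g : ℝ × E → ℝ` be `C²` on an open set
containing `[t₁, ∞) × E`, vanish for `t ≥ T` and for `‖x‖ ≥ R₀`, and satisfy `|g| ≤ W`,
`|∂ₜg + Δg| ≤ N` for `t ≥ t₁`, with `0 < W` and `N < 4K`. Then for `L = √(8KW)` and all
`t ≥ t₁`, `‖x - y‖ ≤ L/(2K)`: `g(t,x) - g(t,y) ≤ L‖x - y‖ - K‖x - y‖²`. [folklore] -/
theorem doubling_sub_le {g : ℝ × E → ℝ} {U : Set (ℝ × E)} {t₁ T R₀ N W K : ℝ}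
    (hU : IsOpen U) (hsub : Ici t₁ ×ˢ univ ⊆ U) (hg : ContDiffOn ℝ 2 g U)
    (hT : ∀ t x, T ≤ t → g (t, x) = 0) (hR : ∀ t x, R₀ ≤ ‖x‖ → g (t, x) = 0)
    (hW : ∀ t x, t₁ ≤ t → |g (t, x)| ≤ W) (hWpos : 0 < W)
    (hN : ∀ t x, t₁ ≤ t → |dt g (t, x) + lap g (t, x)| ≤ N) (hK : N < 4 * K) :
    ∀ t x y, t₁ ≤ t → ‖x - y‖ ≤ Real.sqrt (8 * K * W) / (2 * K) →
      g (t, x) - g (t, y) ≤ Real.sqrt (8 * K * W) * ‖x - y‖ - K * ‖x - y‖ ^ 2 := by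
  have hN0 : 0 ≤ N := (abs_nonneg _).trans (hN t₁ 0 le_rfl)
  have hK0 : 0 < K := by linarith
  set L := Real.sqrt (8 * K * W) with hL
  have hL0 : 0 < L := Real.sqrt_pos.2 (by positivity)
  have hLsq : L ^ 2 = 8 * K * W := Real.sq_sqrt (by positivity)
  set δ := L / (2 * K) with hδ
  have hδ0 : 0 < δ := by positivity
  have hKδ : K * δ = L / 2 := by
    rw [hδ]; field_simp
  -- the barrier `φ`
  set φ : ℝ → ℝ := fun ρ => L * ρ - K * ρ ^ 2 with hφ
  have hφ0 : φ 0 = 0 := by simp [hφ]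
  have hφδ : φ δ = 2 * W := by
    have : φ δ = δ * (L - K * δ) := by simp only [hφ]; ring
    rw [this, hKδ, hδ]
    field_simp
    nlinarith [hLsq]
  have hφnn : ∀ ρ, 0 ≤ ρ → ρ ≤ δ → 0 ≤ φ ρ := by
    intro ρ h0 h1
    have : φ ρ = ρ * (L - K * ρ) := by simp only [hφ]; ring
    rw [this]
    refine mul_nonneg h0 ?_
    have : K * ρ ≤ K * δ := mul_le_mul_of_nonneg_left h1 hK0.le
    linarith
  have hφle : ∀ ρ, φ ρ ≤ L * ρ := fun ρ => by
    simp only [hφ]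
    nlinarith [sq_nonneg ρ]
  -- points where `g` vanishes
  have hgW : ∀ t x, t₁ ≤ t → g (t, x) ≤ W := fun t x ht => (le_abs_self _).trans (hW t x ht)
  have hgW' : ∀ t x, t₁ ≤ t → -W ≤ g (t, x) := fun t x ht => (neg_abs_le _).trans' (by
    simpa using neg_le_neg (hW t x ht)) |>.trans (neg_abs_le _)
  -- suppose the claim fails
  by_contra hcon
  push Not at hcon
  obtain ⟨t', x', y', ht', hxy', hlt⟩ := hcon
  -- the function `Ψ` on `ℝ × E × E`
  set Ψ : ℝ × E × E → ℝ := fun q => g (q.1, q.2.1) - g (q.1, q.2.2) - φ ‖q.2.1 - q.2.2‖ with hΨ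
  have hΨ' : 0 < Ψ (t', x', y') := by
    simp only [hΨ]
    linarith
  -- a compact set carrying the positive part of `Ψ`
  set T' := max T t' with hT'
  set R₁ := max (R₀ + δ) (max ‖x'‖ ‖y'‖) with hR₁
  set D' : Set (ℝ × E × E) :=
    (Icc t₁ T' ×ˢ (closedBall (0 : E) R₁ ×ˢ closedBall (0 : E) R₁)) ∩
      {q | ‖q.2.1 - q.2.2‖ ≤ δ} with hD'
  have hD'c : IsCompact D' := by
    refine (isCompact_Icc.prod ((isCompact_closedBall _ _).prod (isCompact_closedBall _ _))).inter_right ?_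
    exact isClosed_le (by fun_prop) continuous_const
  have hmem' : (t', x', y') ∈ D' := by
    refine ⟨⟨⟨ht', le_max_right _ _⟩, ?_, ?_⟩, hxy'⟩
    · simp only [mem_closedBall, dist_zero_right]
      exact (le_max_left _ _).trans (le_max_right _ _)
    · simp only [mem_closedBall, dist_zero_right]
      exact (le_max_right _ _).trans (le_max_right _ _)
  -- continuity of `Ψ` on `D'`
  have hgc : ContinuousOn g (Ici t₁ ×ˢ univ) := hg.continuousOn.mono hsub
  have hΨc : ContinuousOn Ψ D' := by
    have h1 : ContinuousOn (fun q : ℝ × E × E => g (q.1, q.2.1)) D' := by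
      refine hgc.comp (by fun_prop) ?_
      intro q hq
      exact ⟨mem_Ici.2 hq.1.1.1, mem_univ _⟩
    have h2 : ContinuousOn (fun q : ℝ × E × E => g (q.1, q.2.2)) D' := by
      refine hgc.comp (by fun_prop) ?_
      intro q hq
      exact ⟨mem_Ici.2 hq.1.1.1, mem_univ _⟩
    have h3 : Continuous fun q : ℝ × E × E => φ ‖q.2.1 - q.2.2‖ := by
      simp only [hφ]
      fun_prop
    exact (h1.sub h2).sub h3.continuousOn
  obtain ⟨zm, hzmD, hmax⟩ := hD'c.exists_isMaxOn ⟨_, hmem'⟩ hΨc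
  have hΨpos : 0 < Ψ zm := hΨ'.trans_le (hmax hmem')
  -- `Ψ ≤ Ψ zm` on all of `{t ≥ t₁, ‖x - y‖ ≤ δ}`
  have hglob : ∀ t x y, t₁ ≤ t → ‖x - y‖ ≤ δ → Ψ (t, x, y) ≤ Ψ zm := by
    intro t x y ht hxy
    by_cases hq : (t, x, y) ∈ D'
    · exact hmax hq
    · suffices h : Ψ (t, x, y) ≤ 0 from h.trans hΨpos.le
      have hφ' : 0 ≤ φ ‖x - y‖ := hφnn _ (norm_nonneg _) hxy
      -- off `D'`: `t > T'` or `‖x‖ > R₁` or `‖y‖ > R₁`; in each case both values of `g` vanish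
      have hcases : T' < t ∨ R₁ < ‖x‖ ∨ R₁ < ‖y‖ := by
        by_contra h'
        push Not at h'
        exact hq ⟨⟨⟨ht, h'.1⟩, by simpa using h'.2.1, by simpa using h'.2.2⟩, hxy⟩
      have hzero : g (t, x) = 0 ∧ g (t, y) = 0 := by
        rcases hcases with h1 | h1 | h1
        · have hTt : T ≤ t := (le_max_left _ _).trans h1.le
          exact ⟨hT t x hTt, hT t y hTt⟩
        · have hx0 : R₀ + δ ≤ ‖x‖ := (le_max_left _ _).trans h1.le
          have hy0 : R₀ ≤ ‖y‖ := by
            have := norm_sub_norm_le x y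
            linarith
          exact ⟨hR t x (by linarith), hR t y hy0⟩
        · have hy0 : R₀ + δ ≤ ‖y‖ := (le_max_left _ _).trans h1.le
          have hx0 : R₀ ≤ ‖x‖ := by
            have := norm_sub_norm_le y x
            rw [norm_sub_rev] at this
            linarith
          exact ⟨hR t x hx0, hR t y (by linarith)⟩
      simp only [hΨ, hzero.1, hzero.2]
      linarith
  -- coordinates of the maximum point
  obtain ⟨t₀, x₀, y₀⟩ := zm
  have ht₀ : t₁ ≤ t₀ := hzmD.1.1.1
  have hxy₀ : ‖x₀ - y₀‖ ≤ δ := hzmD.2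
  have hΨ₀ : Ψ (t₀, x₀, y₀) = g (t₀, x₀) - g (t₀, y₀) - φ ‖x₀ - y₀‖ := rfl
  -- `0 < ‖x₀ - y₀‖ < δ`
  set r₀ := ‖x₀ - y₀‖ with hr₀
  have hr₀pos : 0 < r₀ := by
    rcases (norm_nonneg (x₀ - y₀)).lt_or_eq with h | h
    · exact h
    · exfalso
      have hφr : φ r₀ = 0 := by rw [hr₀, ← h, hφ0]
      have hxy : x₀ = y₀ := sub_eq_zero.1 (norm_eq_zero.1 h.symm)
      have : Ψ (t₀, x₀, y₀) = 0 := by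
        rw [hΨ₀, hφr, hxy, sub_self, sub_zero]
      exact hΨpos.ne' this
  have hr₀δ : r₀ < δ := by
    rcases hxy₀.lt_or_eq with h | h
    · exact h
    · exfalso
      have : Ψ (t₀, x₀, y₀) ≤ 0 := by
        rw [hΨ₀, h, hφδ]
        linarith [hgW t₀ x₀ ht₀, hgW' t₀ y₀ ht₀]
      exact absurd hΨpos (not_lt.2 this)
  -- the unit vector `p`
  set p : E := r₀⁻¹ • (x₀ - y₀) with hp
  have hp1 : ‖p‖ = 1 := by
    rw [hp, norm_smul, norm_inv, Real.norm_eq_abs, abs_of_pos hr₀pos, ← hr₀,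
      inv_mul_cancel₀ hr₀pos.ne']
  have hxy_eq : x₀ - y₀ = r₀ • p := by
    rw [hp, smul_smul, mul_inv_cancel₀ hr₀pos.ne', one_smul]
  -- the slice `g (t₀, ·)` is `C²`
  have hgs2 : ContDiff ℝ 2 (fun y => g (t₀, y)) := contDiff_slice_of_subset hsub hg ht₀
  -- (1) parallel translations
  have hpar : ∀ ξ : E, iteratedFDeriv ℝ 2 (fun y => g (t₀, y)) x₀ ![ξ, ξ] -
      iteratedFDeriv ℝ 2 (fun y => g (t₀, y)) y₀ ![ξ, ξ] ≤ 0 := by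
    intro ξ
    refine iteratedFDeriv_sub_nonpos_of_isLocalMax hgs2 x₀ y₀ ξ ?_
    refine Filter.Eventually.of_forall fun σ => ?_
    have h := hglob t₀ (x₀ + σ • ξ) (y₀ + σ • ξ) ht₀ (by
      rw [show x₀ + σ • ξ - (y₀ + σ • ξ) = x₀ - y₀ by abel]; exact hxy₀)
    have e : Ψ (t₀, x₀ + σ • ξ, y₀ + σ • ξ) =
        g (t₀, x₀ + σ • ξ) - g (t₀, y₀ + σ • ξ) - φ ‖x₀ - y₀‖ := by
      simp only [hΨ]
      rw [show x₀ + σ • ξ - (y₀ + σ • ξ) = x₀ - y₀ by abel]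
    rw [e, ← hr₀, hΨ₀] at h
    simpa using h
  -- (2) opposite translations along `p`
  have hopp : iteratedFDeriv ℝ 2 (fun y => g (t₀, y)) x₀ ![p, p] -
      iteratedFDeriv ℝ 2 (fun y => g (t₀, y)) y₀ ![p, p] + 8 * K ≤ 0 := by
    refine iteratedFDeriv_sub_add_le_of_isLocalMax hgs2 x₀ y₀ p L K r₀ ?_
    -- for `|σ|` small the perturbed pair stays in the domain
    have hε : 0 < min r₀ (δ - r₀) / 2 := by
      have : 0 < min r₀ (δ - r₀) := lt_min hr₀pos (by linarith)
      linarith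
    have hev : ∀ᶠ σ : ℝ in 𝓝 0, |σ| < min r₀ (δ - r₀) / 2 := by
      have := Metric.ball_mem_nhds (0 : ℝ) hε
      filter_upwards [this] with σ hσ
      simpa [Real.dist_eq] using hσ
    filter_upwards [hev] with σ hσ
    have hσ1 : |σ| < r₀ / 2 := hσ.trans_le (by
      have := min_le_left r₀ (δ - r₀); linarith)
    have hσ2 : |σ| < (δ - r₀) / 2 := hσ.trans_le (by
      have := min_le_right r₀ (δ - r₀); linarith)
    have habs := abs_lt.1 hσ1
    have habs' := abs_lt.1 hσ2
    have hpos : 0 < r₀ + 2 * σ := by linarith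
    have hle : r₀ + 2 * σ ≤ δ := by linarith
    have hdiff : x₀ + σ • p - (y₀ + σ • (-p)) = (r₀ + 2 * σ) • p := by
      rw [show x₀ + σ • p - (y₀ + σ • (-p)) = (x₀ - y₀) + (2 * σ) • p by
        rw [smul_neg, mul_smul, two_smul]; abel, hxy_eq, ← add_smul]
    have hnorm : ‖x₀ + σ • p - (y₀ + σ • (-p))‖ = r₀ + 2 * σ := by
      rw [hdiff, norm_smul, hp1, mul_one, Real.norm_eq_abs, abs_of_pos hpos]
    have h := hglob t₀ (x₀ + σ • p) (y₀ + σ • (-p)) ht₀ (by rw [hnorm]; exact hle)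
    have eσ : g (t₀, x₀ + σ • p) - g (t₀, y₀ + σ • (-p)) -
        (L * (r₀ + 2 * σ) - K * (r₀ + 2 * σ) ^ 2) = Ψ (t₀, x₀ + σ • p, y₀ + σ • (-p)) := by
      simp only [hΨ, hφ]
      rw [hnorm]
    have e0 : g (t₀, x₀ + (0 : ℝ) • p) - g (t₀, y₀ + (0 : ℝ) • (-p)) -
        (L * (r₀ + 2 * 0) - K * (r₀ + 2 * 0) ^ 2) = Ψ (t₀, x₀, y₀) := by
      rw [hΨ₀]
      simp [hφ]
    rw [eσ, e0]
    exact h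
  -- (3) the Laplacians: `Δgs(x₀) - Δgs(y₀) ≤ -8K`
  obtain ⟨b, i₀, hb⟩ := exists_orthonormalBasis_apply_eq hp1
  have hΔ : (Δ fun y => g (t₀, y)) x₀ - (Δ fun y => g (t₀, y)) y₀ ≤ -(8 * K) := by
    rw [laplacian_eq_iteratedFDeriv_orthonormalBasis (fun y => g (t₀, y)) b]
    simp only
    rw [← Finset.sum_sub_distrib, ← Finset.add_sum_erase _ _ (Finset.mem_univ i₀), hb]
    have hrest : ∑ i ∈ Finset.univ.erase i₀,
        (iteratedFDeriv ℝ 2 (fun y => g (t₀, y)) x₀ ![b i, b i] -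
          iteratedFDeriv ℝ 2 (fun y => g (t₀, y)) y₀ ![b i, b i]) ≤ 0 :=
      Finset.sum_nonpos fun i _ => hpar (b i)
    linarith
  -- (4) the time derivatives: `∂ₜg(t₀,x₀) - ∂ₜg(t₀,y₀) ≤ 0` (one-sided at `t₀ = t₁`)
  have hmemU : ∀ y : E, (t₀, y) ∈ U := fun y => hsub ⟨mem_Ici.2 ht₀, mem_univ y⟩
  have hdiff : ∀ y : E, DifferentiableAt ℝ g (t₀, y) := fun y =>
    (hg.differentiableOn (by norm_num)).differentiableAt (hU.mem_nhds (hmemU y))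
  have htime : dt g (t₀, x₀) - dt g (t₀, y₀) ≤ 0 := by
    have hθ : HasDerivAt (fun s => g (s, x₀) - g (s, y₀)) (dt g (t₀, x₀) - dt g (t₀, y₀)) t₀ :=
      (hasDerivAt_slice_dt (hdiff x₀)).sub (hasDerivAt_slice_dt (hdiff y₀))
    refine hasDerivAt_nonpos_of_forall_gt_le hθ ?_
    filter_upwards [self_mem_nhdsWithin] with s hs
    have hs' : t₁ ≤ s := ht₀.trans (le_of_lt hs)
    have h := hglob s x₀ y₀ hs' hxy₀
    rw [hΨ₀] at h
    simp only [hΨ] at h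
    linarith
  -- (5) the operator at the two points
  have hlapx : lap g (t₀, x₀) = (Δ fun y => g (t₀, y)) x₀ := by
    have h := lap_uncurry (u := Function.curry g) (t := t₀) (x := x₀) hU (hmemU x₀)
      (by rw [Function.uncurry_curry]; exact hg)
    rw [Function.uncurry_curry] at h
    exact h
  have hlapy : lap g (t₀, y₀) = (Δ fun y => g (t₀, y)) y₀ := by
    have h := lap_uncurry (u := Function.curry g) (t := t₀) (x := y₀) hU (hmemU y₀)
      (by rw [Function.uncurry_curry]; exact hg)
    rw [Function.uncurry_curry] at h
    exact h
  have hx := hN t₀ x₀ ht₀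
  have hy := hN t₀ y₀ ht₀
  rw [abs_le] at hx hy
  rw [hlapx] at hx
  rw [hlapy] at hy
  linarith [hx.1, hy.2]

/-- **Lipschitz bound by doubling of variables.** Let `g : ℝ × E → ℝ` be `C²` on an open set
containing `[t₁, ∞) × E`, vanish for `t ≥ T` and for `‖x‖ ≥ R₀`, and satisfy `|g| ≤ W` and
`|∂ₜg + Δg| ≤ N` for `t ≥ t₁`. Then `‖∇ₓ g(t, x)‖ ≤ √(2NW)` for all `t ≥ t₁`, `x ∈ E`. [folklore] -/
theorem norm_fderiv_slice_le_sqrt {g : ℝ × E → ℝ} {U : Set (ℝ × E)} {t₁ T R₀ N W : ℝ}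
    (hU : IsOpen U) (hsub : Ici t₁ ×ˢ univ ⊆ U) (hg : ContDiffOn ℝ 2 g U)
    (hT : ∀ t x, T ≤ t → g (t, x) = 0) (hR : ∀ t x, R₀ ≤ ‖x‖ → g (t, x) = 0)
    (hW : ∀ t x, t₁ ≤ t → |g (t, x)| ≤ W)
    (hN : ∀ t x, t₁ ≤ t → |dt g (t, x) + lap g (t, x)| ≤ N) :
    ∀ t x, t₁ ≤ t → ‖fderiv ℝ (fun y => g (t, y)) x‖ ≤ Real.sqrt (2 * N * W) := by
  intro t x ht
  have hN0 : 0 ≤ N := (abs_nonneg _).trans (hN t₁ 0 le_rfl)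
  have hW0 : 0 ≤ W := (abs_nonneg _).trans (hW t₁ 0 le_rfl)
  rcases hW0.lt_or_eq with hWpos | hW0'
  swap
  · -- `W = 0`: the slice vanishes identically
    have hzero : (fun y => g (t, y)) = fun _ => 0 := by
      funext y
      have := hW t y ht
      rw [← hW0'] at this
      exact abs_nonpos_iff.1 this
    rw [hzero, fderiv_fun_const]
    simp
  -- `W > 0`: the bound `√(8KW)` for every `K > N/4`
  have hgs2 : ContDiff ℝ 2 fun y => g (t, y) := contDiff_slice_of_subset hsub hg ht
  have hmain : ∀ K : ℝ, N < 4 * K → ‖fderiv ℝ (fun y => g (t, y)) x‖ ≤ Real.sqrt (8 * K * W) := by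
    intro K hK
    have hK0 : 0 < K := by linarith
    set L := Real.sqrt (8 * K * W) with hL
    have hL0 : 0 < L := Real.sqrt_pos.2 (by positivity)
    have hδ0 : 0 < L / (2 * K) := by positivity
    have hsub_le := doubling_sub_le hU hsub hg hT hR hW hWpos hN hK
    have hf : HasFDerivAt (fun y => g (t, y)) (fderiv ℝ (fun y => g (t, y)) x) x :=
      ((hgs2.differentiable (by norm_num)) x).hasFDerivAt
    refine hf.le_of_lip' hL0.le ?_
    filter_upwards [Metric.ball_mem_nhds x hδ0] with y hy
    rw [mem_ball, dist_eq_norm] at hy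
    have h1 := hsub_le t y x ht hy.le
    have h2 := hsub_le t x y ht (by rw [norm_sub_rev]; exact hy.le)
    rw [norm_sub_rev] at h2
    have hK' : 0 ≤ K * ‖y - x‖ ^ 2 := by positivity
    rw [Real.norm_eq_abs, abs_le]
    constructor <;> linarith
  -- let `K ↓ N/4`
  set D₀ := ‖fderiv ℝ (fun y => g (t, y)) x‖ with hD₀
  have hD0 : 0 ≤ D₀ := norm_nonneg _
  have hsq : D₀ ^ 2 ≤ 2 * N * W := by
    refine le_of_forall_gt_imp_ge_of_dense fun c hc => ?_
    have hK : N < 4 * (c / (8 * W)) := by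
      rw [show 4 * (c / (8 * W)) = c / (2 * W) by ring]
      rw [lt_div_iff₀ (by positivity)]
      linarith
    have h := hmain _ hK
    rw [show 8 * (c / (8 * W)) * W = c by field_simp] at h
    have hc0 : 0 ≤ c := by nlinarith
    calc D₀ ^ 2 ≤ Real.sqrt c ^ 2 := pow_le_pow_left₀ hD0 h 2
      _ = c := Real.sq_sqrt hc0
  calc D₀ = Real.sqrt (D₀ ^ 2) := (Real.sqrt_sq hD0).symm
    _ ≤ Real.sqrt (2 * N * W) := Real.sqrt_le_sqrt hsq

end Doubling

/-! ### Vector-valued functions -/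

section Vector

variable {E : Type*} [NormedAddCommGroup E] [InnerProductSpace ℝ E] [FiniteDimensional ℝ E]
variable {F : Type*} [NormedAddCommGroup F] [InnerProductSpace ℝ F]

omit [FiniteDimensional ℝ E] in
/-- For `w` differentiable at `z`: `D⟪w, v⟫(z) h = ⟪Dw(z) h, v⟫`. [folklore] -/
theorem fderiv_inner_const_apply {w : ℝ × E → F} {z : ℝ × E} (hw : DifferentiableAt ℝ w z)
    (v : F) (h : ℝ × E) :
    fderiv ℝ (fun z => ⟪w z, v⟫) z h = ⟪fderiv ℝ w z h, v⟫ := by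
  rw [fderiv_inner_apply ℝ hw (differentiableAt_const v)]
  simp

/-- `(∂ₜ + Δ)⟪w, v⟫ = ⟪(∂ₜ + Δ)w, v⟫` at points of an open set where `w` is `C²`. [folklore] -/
theorem dt_add_lap_inner_const {w : ℝ × E → F} {U : Set (ℝ × E)} (hU : IsOpen U)
    (hw : ContDiffOn ℝ 2 w U) (v : F) {z : ℝ × E} (hz : z ∈ U) :
    dt (fun z => ⟪w z, v⟫) z + lap (fun z => ⟪w z, v⟫) z = ⟪dt w z + lap w z, v⟫ := by
  have hd : ∀ z' ∈ U, DifferentiableAt ℝ w z' := fun z' hz' =>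
    (hw.differentiableOn (by norm_num)).differentiableAt (hU.mem_nhds hz')
  have h1 : dt (fun z => ⟪w z, v⟫) z = ⟪dt w z, v⟫ := by
    simp only [dt_apply]
    exact fderiv_inner_const_apply (hd z hz) v _
  have h2 : ∀ e : E, dx e (dx e fun z => ⟪w z, v⟫) z = ⟪dx e (dx e w) z, v⟫ := by
    intro e
    -- near `z`, `dx e ⟪w, v⟫ = ⟪dx e w, v⟫`
    have hev : dx e (fun z => ⟪w z, v⟫) =ᶠ[𝓝 z] fun z' => ⟪dx e w z', v⟫ := by
      filter_upwards [hU.mem_nhds hz] with z' hz'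
      simp only [dx_apply]
      exact fderiv_inner_const_apply (hd z' hz') v _
    rw [dx_apply, hev.fderiv_eq]
    have hdx : DifferentiableAt ℝ (dx e w) z := by
      have hc : ContDiffOn ℝ 1 (fun z' => fderiv ℝ w z' (0, e)) U :=
        (hw.fderiv_of_isOpen hU le_rfl).clm_apply contDiffOn_const
      exact (hc.differentiableOn one_ne_zero).differentiableAt (hU.mem_nhds hz)
    rw [fderiv_inner_const_apply hdx v _]
    rfl
  rw [h1, lap, lap, inner_add_left, sum_inner]
  congr 1
  exact Finset.sum_congr rfl fun i _ => h2 _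

omit [FiniteDimensional ℝ E] in
/-- Spatial frame derivatives are slice derivatives: `dx e w (t, x) = D(w(t, ·))(x) e`. [folklore] -/
theorem dx_eq_fderiv_slice {w : ℝ × E → F} {t : ℝ} {x : E} (hw : DifferentiableAt ℝ w (t, x))
    (e : E) : dx e w (t, x) = fderiv ℝ (fun y => w (t, y)) x e := by
  rw [dx_apply, fderiv_apply_zero_eq_fderiv_slice hw]

/-- **Gradient bound by doubling of variables, vector-valued form.** Let `w : ℝ × E → F` be `C²`
on an open set containing `[t₁, ∞) × E`, vanish for `t ≥ T` and for `‖x‖ ≥ R₀`, and satisfy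
`‖w‖ ≤ W` and `‖∂ₜw + Δw‖ ≤ N` for `t ≥ t₁`. Then `|∇ₓw(t, x)|² ≤ (dim E) · 2NW` for all
`t ≥ t₁`, `x ∈ E`. [folklore] -/
theorem gradSq_le_of_sub_le {w : ℝ × E → F} {U : Set (ℝ × E)} {t₁ T R₀ N W : ℝ}
    (hU : IsOpen U) (hsub : Ici t₁ ×ˢ univ ⊆ U) (hw : ContDiffOn ℝ 2 w U)
    (hT : ∀ t x, T ≤ t → w (t, x) = 0) (hR : ∀ t x, R₀ ≤ ‖x‖ → w (t, x) = 0)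
    (hW : ∀ t x, t₁ ≤ t → ‖w (t, x)‖ ≤ W)
    (hN : ∀ t x, t₁ ≤ t → ‖dt w (t, x) + lap w (t, x)‖ ≤ N) :
    ∀ t x, t₁ ≤ t → gradSq w (t, x) ≤ Module.finrank ℝ E * (2 * N * W) := by
  intro t x ht
  have hN0 : 0 ≤ N := (norm_nonneg _).trans (hN t₁ 0 le_rfl)
  have hW0 : 0 ≤ W := (norm_nonneg _).trans (hW t₁ 0 le_rfl)
  -- the scalar functions `⟪w, v⟫`
  have hscalar : ∀ v : F, ‖fderiv ℝ (fun y => ⟪w (t, y), v⟫) x‖ ≤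
      Real.sqrt (2 * (N * ‖v‖) * (W * ‖v‖)) := by
    intro v
    have hg : ContDiffOn ℝ 2 (fun z => ⟪w z, v⟫) U := hw.inner ℝ contDiffOn_const
    refine norm_fderiv_slice_le_sqrt (g := fun z => ⟪w z, v⟫) (T := T) (R₀ := R₀) hU hsub hg
      (fun t x htx => by simp [hT t x htx]) (fun t x htx => by simp [hR t x htx])
      (fun t x htx => ?_) (fun t x htx => ?_) t x ht
    · exact (abs_real_inner_le_norm _ _).trans (mul_le_mul_of_nonneg_right (hW t x htx) (norm_nonneg _))
    · have hz : (t, x) ∈ U := hsub ⟨mem_Ici.2 htx, mem_univ x⟩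
      rw [dt_add_lap_inner_const hU hw v hz]
      exact (abs_real_inner_le_norm _ _).trans (mul_le_mul_of_nonneg_right (hN t x htx) (norm_nonneg _))
  -- each frame derivative is bounded by `√(2NW)`
  have hz : (t, x) ∈ U := hsub ⟨mem_Ici.2 ht, mem_univ x⟩
  have hd : DifferentiableAt ℝ w (t, x) :=
    (hw.differentiableOn (by norm_num)).differentiableAt (hU.mem_nhds hz)
  have hds : DifferentiableAt ℝ (fun y => w (t, y)) x :=
    hd.comp x ((differentiableAt_const _).prodMk differentiableAt_id)
  have hcomp : ∀ e : E, ‖e‖ = 1 → ‖dx e w (t, x)‖ ≤ Real.sqrt (2 * N * W) := by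
    intro e he
    set Y := dx e w (t, x) with hY
    have hYs : Y = fderiv ℝ (fun y => w (t, y)) x e := dx_eq_fderiv_slice hd e
    -- test against `v = Y`
    have h1 : fderiv ℝ (fun y => ⟪w (t, y), Y⟫) x e = ‖Y‖ ^ 2 := by
      rw [fderiv_inner_apply ℝ hds (differentiableAt_const Y)]
      simp [← hYs]
    have h2 : ‖Y‖ ^ 2 ≤ ‖Y‖ * Real.sqrt (2 * N * W) := by
      calc ‖Y‖ ^ 2 = fderiv ℝ (fun y => ⟪w (t, y), Y⟫) x e := h1.symm
        _ ≤ ‖fderiv ℝ (fun y => ⟪w (t, y), Y⟫) x e‖ := Real.le_norm_self _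
        _ ≤ ‖fderiv ℝ (fun y => ⟪w (t, y), Y⟫) x‖ * ‖e‖ := ContinuousLinearMap.le_opNorm _ _
        _ ≤ Real.sqrt (2 * (N * ‖Y‖) * (W * ‖Y‖)) * 1 := by
            rw [he]; exact mul_le_mul_of_nonneg_right (hscalar Y) zero_le_one
        _ = ‖Y‖ * Real.sqrt (2 * N * W) := by
            rw [mul_one, show 2 * (N * ‖Y‖) * (W * ‖Y‖) = ‖Y‖ ^ 2 * (2 * N * W) by ring,
              Real.sqrt_mul (sq_nonneg _), Real.sqrt_sq (norm_nonneg _)]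
    rcases (norm_nonneg Y).lt_or_eq with hpos | h0
    · exact le_of_mul_le_mul_left (by nlinarith [h2]) hpos
    · rw [← h0]; exact Real.sqrt_nonneg _
  -- sum over the frame
  have hcard : (Finset.univ : Finset (Fin (Module.finrank ℝ E))).card = Module.finrank ℝ E := by
    simp
  calc gradSq w (t, x) = ∑ i, ‖dx (stdOrthonormalBasis ℝ E i) w (t, x)‖ ^ 2 := rfl
    _ ≤ ∑ _i : Fin (Module.finrank ℝ E), (2 * N * W) := by
        refine Finset.sum_le_sum fun i _ => ?_
        have h := hcomp _ ((stdOrthonormalBasis ℝ E).orthonormal.1 i)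
        calc ‖dx (stdOrthonormalBasis ℝ E i) w (t, x)‖ ^ 2 ≤ Real.sqrt (2 * N * W) ^ 2 :=
              pow_le_pow_left₀ (norm_nonneg _) h 2
          _ = 2 * N * W := Real.sq_sqrt (by positivity)
    _ = Module.finrank ℝ E * (2 * N * W) := by
        rw [Finset.sum_const, hcard, nsmul_eq_mul]

end Vector

end Carleman

end Literature.Analysis.FluidPDE
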